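import Summits.QuantumFields.YangMills.Theorems.PoincareLipschitzSmallRangeOfOneStep
import HarnessLib

/-!
# Line «poincare_lipschitz» on crux `HistoryTailL` (stmt-QuantumFields-19936), K2 organ of record LOC-REG-MIN — E→R ROAD, BRICK F6 (sequel): THE DOOR
# ‹ONE-STEP IMPROVEMENT ⟹ SMALL RANGE› IN F5d-A's RADIUS BOOKKEEPING (harmonic ratio `((ρ+1)∕(r−1))^d`, range `ρ + 2 ≤ r`)

Cell `ym3-torus` (YM ladder rung R3 = continuum SU(2) Yang–Mills on the three-torus — a RUNG, NOT the Clay problem: not d = 4, not infinite volume, not a mass gap);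
width seat `ym3-torus-px8` gen 5 (LEAD ym-ust-19936-w1 g8).  THEOREMS ONLY (def-free); `--supports stmt-QuantumFields-19936 --as helper`.  Sibling of ✓`PoincareLipschitzSmallRangeOfOneStep`
(px8 g5, F6): ★w5-19936 g12's F5d-A ✓∕⧗`PoincareLipschitzSphereMapEnergyDecayOfComparison.energy_decay_of_comparison` prints the one-step improvement with the harmonic
ratio `((ρ+1)∕(((R−2 : ℤ) : ℝ)+1))^d = ((ρ+1)∕(R−1))^d` on the range `0 ≤ ρ ≤ R − 2`, while F6's socket `hone` reads `((ρ+1)∕r)^d` on `ρ + 1 ≤ r`.  This file moves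
the bookkeeping to the CONSUMER side («consumer names the letters», and pays for them): the same door with the supplier's ratio and range, at the price `m ≥ 3`,
`2·4^d·A ≤ m`.  NOTHING of F5, E→R, LOC-REG-MIN, `hReg`, `hImprove`, a stub, `BlockLipschitzL`, `HistoryTailL` or a summit statement is proved here.

* `geometricStep_of_oneStep_pred` — BRIDGE: the one-step improvement in F5d-A's bookkeeping ⟹ the ladder step `E(m^k) ≤ (m^{d−1})⁻¹·E(m^{k+1})` (at `ρ = m^k`,
  `r = m^{k+1}`: `ρ + 2 ≤ r`, `(ρ+1)∕(r−1) ≤ 4∕m`, `A(4∕m)^d + ε ≤ (m^{d−1})⁻¹`).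
* ★★★ `norm_sub_le_of_oneStep_pred` — THE DOOR with that socket: `∀ x ∈ Q_{ρ₀}(a), ∀ ρ r, 1 ≤ ρ → ρ + 2 ≤ r → r ≤ m^K → E x r ≤ T r →
  E x ρ ≤ (A·((ρ+1)∕(r−1))^d + ε)·E x r` ⟹ `‖u x′ − u a‖ ≤ 17·√(16d8^d)·√(m^{d−1}·Etop∕(m^K)^{d−1}·(2ρ₀+1))` on `Q_{ρ₀}(a)`.
[folklore] ([Giaquinta1984] Ch. III Lemma 2.1, Thm 1.2; [SchoenUhlenbeck1982] §4; lattice statements are this file's and F6's).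
-/

set_option autoImplicit false

noncomputable section

open scoped BigOperators InnerProductSpace
open Finset

namespace Summit.QuantumFields.YangMills.Theorems.PoincareLipschitzSmallRangeOfOneStepPred

open Literature.MathematicalPhysics.QuantumFieldTheory.Balaban1983to89
open B4Eq19LatticeOperators
open Summit.QuantumFields.YangMills.Theorems.PoincareLipschitzSmallRangeOfOneStep (norm_sub_le_of_geometricStep)

variable {d : ℕ} {V : Type*} [NormedAddCommGroup V] [InnerProductSpace ℝ V]

/-- **BRIDGE, F5d-A BOOKKEEPING** (★w5-19936 g12's `energy_decay_of_comparison`: harmonic ratio `((ρ+1)∕(R−1))^d`, range `0 ≤ ρ ≤ R − 2`).  If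
`E r ≤ T r → E ρ ≤ (A·((ρ+1)∕(r−1))^d + ε)·E r` for `1 ≤ ρ`, `ρ + 2 ≤ r ≤ m^K`, with `E ≥ 0`, `A ≥ 0`, `m ≥ 3`, `2·4^d·A ≤ m`, `ε ≤ ½·(m^{d−1})⁻¹`, then the ladder step
holds: at `ρ = m^k`, `r = m^{k+1}` one has `ρ + 2 ≤ r`, `(ρ+1)∕(r−1) ≤ 4∕m` and `A(4∕m)^d + ε ≤ (m^{d−1})⁻¹`. [folklore] -/
theorem geometricStep_of_oneStep_pred (hd : 1 ≤ d) (E T : ℤ → ℝ) (hE0 : ∀ ρ, 0 ≤ E ρ) {A ε : ℝ} (hA : 0 ≤ A) {m : ℕ} (hm : 3 ≤ m)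
    (hmA : 2 * (4 : ℝ) ^ d * A ≤ m) (hε : ε ≤ 1 / 2 * ((m : ℝ) ^ (d - 1))⁻¹) (K : ℕ)
    (hone : ∀ ρ r : ℤ, 1 ≤ ρ → ρ + 2 ≤ r → r ≤ (m : ℤ) ^ K → E r ≤ T r → E ρ ≤ (A * (((ρ : ℝ) + 1) / ((r : ℝ) - 1)) ^ d + ε) * E r) :
    ∀ k, k < K → E ((m : ℤ) ^ (k + 1)) ≤ T ((m : ℤ) ^ (k + 1)) → E ((m : ℤ) ^ k) ≤ ((m : ℝ) ^ (d - 1))⁻¹ * E ((m : ℤ) ^ (k + 1)) := by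
  intro k hk hthr
  have hm0 : (0 : ℝ) < m := by exact_mod_cast (by omega : 0 < m)
  have hm3 : (3 : ℝ) ≤ m := by exact_mod_cast hm
  have hmz1 : (1 : ℤ) ≤ (m : ℤ) ^ k := one_le_pow₀ (by exact_mod_cast (by omega : 1 ≤ m))
  have hmz2 : (m : ℤ) ^ k + 2 ≤ (m : ℤ) ^ (k + 1) := by
    have h1 : (m : ℤ) ^ k * 3 ≤ (m : ℤ) ^ k * m := mul_le_mul_of_nonneg_left (by exact_mod_cast hm) (by positivity)
    rw [pow_succ]; linarith
  have hmz3 : (m : ℤ) ^ (k + 1) ≤ (m : ℤ) ^ K := pow_le_pow_right₀ (by exact_mod_cast (by omega : 1 ≤ m)) (by omega)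
  have h := hone ((m : ℤ) ^ k) ((m : ℤ) ^ (k + 1)) hmz1 hmz2 hmz3 hthr
  have hEr := hE0 ((m : ℤ) ^ (k + 1))
  -- the ratio: `(m^k + 1)/(m^{k+1} − 1) ≤ 4/m`
  have hmk1 : (1 : ℝ) ≤ (m : ℝ) ^ k := one_le_pow₀ (by linarith)
  have hden : (0 : ℝ) < (m : ℝ) ^ (k + 1) - 1 := by
    have : (m : ℝ) ^ k * 3 ≤ (m : ℝ) ^ k * m := mul_le_mul_of_nonneg_left hm3 (by positivity)
    rw [pow_succ]; nlinarith
  have hratio : (((((m : ℤ) ^ k : ℤ) : ℝ) + 1) / ((((m : ℤ) ^ (k + 1) : ℤ) : ℝ) - 1)) ^ d ≤ (4 / (m : ℝ)) ^ d := by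
    push_cast
    refine pow_le_pow_left₀ (div_nonneg (by positivity) hden.le) ?_ d
    rw [div_le_div_iff₀ hden hm0, pow_succ]
    nlinarith
  -- `A (4/m)^d + ε ≤ (m^{d-1})⁻¹`
  have hkey : A * (4 / (m : ℝ)) ^ d + ε ≤ ((m : ℝ) ^ (d - 1))⁻¹ := by
    obtain ⟨d', rfl⟩ : ∃ d', d = d' + 1 := ⟨d - 1, by omega⟩
    simp only [add_tsub_cancel_right] at hε ⊢
    have hmd : (0 : ℝ) < (m : ℝ) ^ d' := pow_pos hm0 d'
    have e1 : A * (4 / (m : ℝ)) ^ (d' + 1) = (4 ^ (d' + 1) * A) / m * ((m : ℝ) ^ d')⁻¹ := by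
      rw [div_pow, pow_succ (m : ℝ) d']
      field_simp
    have e2 : (4 : ℝ) ^ (d' + 1) * A / m ≤ 1 / 2 := by
      rw [div_le_iff₀ hm0]
      have : 2 * (4 : ℝ) ^ (d' + 1) * A ≤ m := hmA
      linarith
    rw [e1]
    have := mul_le_mul_of_nonneg_right e2 (inv_pos.2 hmd).le
    linarith
  calc E ((m : ℤ) ^ k) ≤ (A * (((((m : ℤ) ^ k : ℤ) : ℝ) + 1) / ((((m : ℤ) ^ (k + 1) : ℤ) : ℝ) - 1)) ^ d + ε) * E ((m : ℤ) ^ (k + 1)) := h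
    _ ≤ (A * (4 / (m : ℝ)) ^ d + ε) * E ((m : ℤ) ^ (k + 1)) := by
        refine mul_le_mul_of_nonneg_right ?_ hEr
        have := mul_le_mul_of_nonneg_left hratio hA
        linarith
    _ ≤ ((m : ℝ) ^ (d - 1))⁻¹ * E ((m : ℤ) ^ (k + 1)) := mul_le_mul_of_nonneg_right hkey hEr

/-- ★★★ **THE DOOR IN F5d-A's RADIUS BOOKKEEPING.**  As ✓`norm_sub_le_of_oneStep`, but the one-step improvement is asked only for `ρ + 2 ≤ r` and with the harmonic
ratio `((ρ+1)∕(r−1))^d` — ★w5-19936 g12's `energy_decay_of_comparison` shape verbatim (its `(((r − 2 : ℤ) : ℝ) + 1)` IS `(r : ℝ) − 1` by `push_cast; ring`); price: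
`m ≥ 3` and `2·4^d·A ≤ m`. [folklore] [cite: Giaquinta1984, Ch. III Lemma 2.1 p.86, Thm 1.2 p.70; SchoenUhlenbeck1982, §4] -/
theorem norm_sub_le_of_oneStep_pred (hd : 1 ≤ d) (u : Zd d → V) (E : Zd d → ℤ → ℝ)
    (hE : ∀ x ρ, E x ρ = ∑ y ∈ box x ρ, ∑ μ, ‖u (y + unitVec μ) - u y‖ ^ 2)
    (T : ℤ → ℝ) {A ε : ℝ} (hA : 0 ≤ A) {m : ℕ} (hm : 3 ≤ m) (hmA : 2 * (4 : ℝ) ^ d * A ≤ m) (hε : ε ≤ 1 / 2 * ((m : ℝ) ^ (d - 1))⁻¹)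
    (K : ℕ) (a : Zd d) {ρ₀ : ℕ} (hρ₀ : 1 ≤ ρ₀) (h2ρ₀ : 2 * (ρ₀ : ℤ) ≤ (m : ℤ) ^ K)
    (hT : ∀ k, k < K → ((m : ℝ) ^ (d - 1))⁻¹ * T ((m : ℤ) ^ (k + 1)) ≤ T ((m : ℤ) ^ k))
    (hone : ∀ x ∈ box a (ρ₀ : ℤ), ∀ ρ r : ℤ, 1 ≤ ρ → ρ + 2 ≤ r → r ≤ (m : ℤ) ^ K → E x r ≤ T r →
      E x ρ ≤ (A * (((ρ : ℝ) + 1) / ((r : ℝ) - 1)) ^ d + ε) * E x r)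
    {Etop : ℝ} (htop : ∀ x ∈ box a (ρ₀ : ℤ), E x ((m : ℤ) ^ K) ≤ Etop) (hthr : ∀ x ∈ box a (ρ₀ : ℤ), E x ((m : ℤ) ^ K) ≤ T ((m : ℤ) ^ K)) :
    ∀ x' ∈ box a (ρ₀ : ℤ), ‖u x' - u a‖ ≤
      17 * Real.sqrt (16 * d * 8 ^ d) * Real.sqrt (((m : ℝ) ^ (d - 1) * Etop / ((m : ℝ) ^ K) ^ (d - 1)) * (2 * (ρ₀ : ℝ) + 1)) := by
  have hE0 : ∀ x ρ, 0 ≤ E x ρ := fun x ρ => by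
    rw [hE]; exact Finset.sum_nonneg fun _ _ => Finset.sum_nonneg fun _ _ => sq_nonneg _
  exact norm_sub_le_of_geometricStep hd u E hE T (by omega) K a hρ₀ h2ρ₀ hT
    (fun x hx => geometricStep_of_oneStep_pred hd (E x) T (hE0 x) hA hm hmA hε K (hone x hx)) htop hthr

end Summit.QuantumFields.YangMills.Theorems.PoincareLipschitzSmallRangeOfOneStepPred

end
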